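import Mathlib
import HarnessLib

/-!
# Parametric-integral tools for the rate obstruction `NoFastBlowDown` (Tools B2)

Tools file B2 of the unconditional rate obstruction `NoFastBlowDown` for the witnesses of the crux
`Summit.AnomalousDissipation.AnomalousDissipation.Theses.DyadicWallCascade.ViscousContinuation`
(stmt-AnomalousDissipation-17917, line SketchIdeator4, lead c1).

The endgame of the rate obstruction is one-dimensional calculus in the height variable `z` of
horizontal weighted averages `g(z) = ∫∫ k(x) k(y) G(x, y, z) dx dy` of a smooth `G` on `ℝ³`
(`ℝ³ = EuclideanSpace ℝ (Fin 3)`, points `!₂[x, y, z]`), for a continuous compactly supported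
weight `k`.  This file supplies:

* `noFastBlowDown_param_integrable` — integrability on `ℝ²` of `k(x) k(y) G(x, y, z)` for
  continuous `G` (continuous with compact support in `tsupport k × tsupport k`);
* `noFastBlowDown_param_continuous` — continuity of `z ↦ g(z)` for continuous `G` (a parametric
  integral over the compact set `tsupport k × tsupport k`);
* `noFastBlowDown_param_hasDerivAt` — differentiation under the integral sign,
  `g'(z) = ∫∫ k(x) k(y) ∂_z G(x, y, z)` for `C¹` maps `G`
  (`hasDerivAt_integral_of_dominated_loc_of_deriv_le`, the pointwise derivatives coming from the
  chain rule along the vertical lines `s ↦ (x, y, s)`);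
* `noFastBlowDown_param_fubini_tools` — the one-variable versions: integrability of
  `y ↦ k(y) H(x, y, z)` and continuity of `x ↦ ∫ k(y) H(x, y, z) dy`, and symmetrically.

All statements are folklore calculus; the file ends with the registered tools stub
`stub_noFastBlowDownParamTools` (conjunction of the four statements).
-/

open MeasureTheory Set Filter Topology Function

set_option linter.dupNamespace false

noncomputable section

namespace Summit.AnomalousDissipation.AnomalousDissipation.Theorems

/-! ## Integrability and continuity of the horizontal averages -/

/-- **Integrability of the weighted slice integrand.** For a continuous compactly supported
weight `k` and a continuous `G` on `ℝ³`, the integrand `(x, y) ↦ k(x) k(y) G(x, y, z)` is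
continuous with compact support in `tsupport k × tsupport k`, hence integrable on `ℝ²`.
[folklore] -/
theorem noFastBlowDown_param_integrable (k : ℝ → ℝ) (G : EuclideanSpace ℝ (Fin 3) → ℝ)
    (hk : Continuous k) (hkc : HasCompactSupport k) (hG : Continuous G) (z : ℝ) :
    Integrable (fun q : ℝ × ℝ => k q.1 * k q.2 * G !₂[q.1, q.2, z]) := by
  have hc : Continuous fun q : ℝ × ℝ => k q.1 * k q.2 * G !₂[q.1, q.2, z] := by fun_prop
  refine hc.integrable_of_hasCompactSupport
    (HasCompactSupport.of_support_subset_isCompact (hkc.isCompact.prod hkc.isCompact) ?_)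
  intro q hq
  rw [mem_support] at hq
  have h1 : k q.1 ≠ 0 := fun h0 => hq (by rw [h0, zero_mul, zero_mul])
  have h2 : k q.2 ≠ 0 := fun h0 => hq (by rw [h0, mul_zero, zero_mul])
  exact ⟨subset_tsupport _ h1, subset_tsupport _ h2⟩

/-- Off `tsupport k × tsupport k` the weighted slice integrand `k(x) k(y) G(x, y, z)` vanishes.
[folklore] -/
theorem noFastBlowDown_param_eq_zero_off (k : ℝ → ℝ) (G : EuclideanSpace ℝ (Fin 3) → ℝ)
    (z : ℝ) (q : ℝ × ℝ) (hq : q ∉ tsupport k ×ˢ tsupport k) :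
    k q.1 * k q.2 * G !₂[q.1, q.2, z] = 0 := by
  rcases not_and_or.1 hq with h | h
  · rw [image_eq_zero_of_notMem_tsupport h, zero_mul, zero_mul]
  · rw [image_eq_zero_of_notMem_tsupport h, mul_zero, zero_mul]

/-- **Continuity of the horizontal averages.** For a continuous compactly supported weight `k`
and a continuous `G` on `ℝ³`, `z ↦ ∫∫ k(x) k(y) G(x, y, z) dx dy` is continuous: it is a
parametric integral of a jointly continuous integrand over the compact set
`tsupport k × tsupport k`. [folklore] -/
theorem noFastBlowDown_param_continuous (k : ℝ → ℝ) (G : EuclideanSpace ℝ (Fin 3) → ℝ)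
    (hk : Continuous k) (hkc : HasCompactSupport k) (hG : Continuous G) :
    Continuous (fun z : ℝ => ∫ q : ℝ × ℝ, k q.1 * k q.2 * G !₂[q.1, q.2, z]) := by
  have hK : IsCompact (tsupport k ×ˢ tsupport k) := hkc.isCompact.prod hkc.isCompact
  have heq : (fun z : ℝ => ∫ q : ℝ × ℝ, k q.1 * k q.2 * G !₂[q.1, q.2, z]) =
      fun z => ∫ q in tsupport k ×ˢ tsupport k, k q.1 * k q.2 * G !₂[q.1, q.2, z] := by
    funext z
    exact (setIntegral_eq_integral_of_forall_compl_eq_zero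
      (noFastBlowDown_param_eq_zero_off k G z)).symm
  rw [heq]
  exact continuous_parametric_integral_of_continuous
    (f := fun (z : ℝ) (q : ℝ × ℝ) => k q.1 * k q.2 * G !₂[q.1, q.2, z]) (by fun_prop) hK

/-! ## Differentiation under the integral sign -/

/-- **Differentiation of the horizontal averages under the integral sign.** For a continuous
compactly supported weight `k` and a `C¹` map `G` on `ℝ³`, `z ↦ ∫∫ k(x) k(y) G(x, y, z) dx dy`
has derivative `∫∫ k(x) k(y) ∂_z G(x, y, z) dx dy` at every `z`, where
`∂_z G = DG (EuclideanSpace.single 2 1)`: on `|z' - z| < 1` the `z`-derivatives of the integrands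
are dominated by `|k(x) k(y)| M` with `M` a bound of `∂_z G` on the compact set
`tsupport k × tsupport k × [z - 1, z + 1]`. [folklore] -/
theorem noFastBlowDown_param_hasDerivAt (k : ℝ → ℝ) (G : EuclideanSpace ℝ (Fin 3) → ℝ)
    (hk : Continuous k) (hkc : HasCompactSupport k) (hG : ContDiff ℝ 1 G) (z : ℝ) :
    HasDerivAt (fun z : ℝ => ∫ q : ℝ × ℝ, k q.1 * k q.2 * G !₂[q.1, q.2, z])
      (∫ q : ℝ × ℝ, k q.1 * k q.2 *
        fderiv ℝ G !₂[q.1, q.2, z] (EuclideanSpace.single 2 (1 : ℝ))) z := by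
  set K : Set ℝ := tsupport k
  have hKc : IsCompact K := hkc.isCompact
  have hGc : Continuous G := hG.continuous
  -- the `z`-partial derivative of `G` is continuous
  have hDc : Continuous fun Y : EuclideanSpace ℝ (Fin 3) =>
      fderiv ℝ G Y (EuclideanSpace.single 2 (1 : ℝ)) :=
    (hG.continuous_fderiv one_ne_zero).clm_apply continuous_const
  -- a bound of the `z`-partial derivative on `K × K × [z - 1, z + 1]`
  have hSc : IsCompact ((K ×ˢ K) ×ˢ Icc (z - 1) (z + 1)) := (hKc.prod hKc).prod isCompact_Icc
  have hfc : Continuous fun p : (ℝ × ℝ) × ℝ =>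
      fderiv ℝ G !₂[p.1.1, p.1.2, p.2] (EuclideanSpace.single 2 (1 : ℝ)) :=
    hDc.comp (by fun_prop)
  obtain ⟨M, hM⟩ := hSc.exists_bound_of_continuousOn hfc.continuousOn
  -- the hypotheses of the dominated differentiation theorem
  have hmeas : ∀ᶠ z' in 𝓝 z, AEStronglyMeasurable
      (fun q : ℝ × ℝ => k q.1 * k q.2 * G !₂[q.1, q.2, z']) (volume : Measure (ℝ × ℝ)) :=
    Eventually.of_forall fun z' =>
      (noFastBlowDown_param_integrable k G hk hkc hGc z').aestronglyMeasurable
  have hint : Integrable (fun q : ℝ × ℝ => k q.1 * k q.2 * G !₂[q.1, q.2, z]) :=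
    noFastBlowDown_param_integrable k G hk hkc hGc z
  have hmeas' : AEStronglyMeasurable (fun q : ℝ × ℝ => k q.1 * k q.2 *
      fderiv ℝ G !₂[q.1, q.2, z] (EuclideanSpace.single 2 (1 : ℝ))) (volume : Measure (ℝ × ℝ)) :=
    (noFastBlowDown_param_integrable k _ hk hkc hDc z).aestronglyMeasurable
  have hbound : ∀ᵐ q ∂(volume : Measure (ℝ × ℝ)), ∀ z' ∈ Metric.ball z 1,
      ‖k q.1 * k q.2 * fderiv ℝ G !₂[q.1, q.2, z'] (EuclideanSpace.single 2 (1 : ℝ))‖ ≤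
        ‖k q.1 * k q.2 * M‖ := by
    refine ae_of_all _ fun q z' hz' => ?_
    by_cases hq : q ∈ K ×ˢ K
    · have hz'' : z' ∈ Icc (z - 1) (z + 1) := by
        rw [Metric.mem_ball, Real.dist_eq, abs_lt] at hz'
        exact ⟨by linarith, by linarith⟩
      rw [norm_mul, norm_mul (k q.1 * k q.2)]
      refine mul_le_mul_of_nonneg_left ?_ (norm_nonneg _)
      exact (hM (q, z') (mk_mem_prod hq hz'')).trans (le_abs_self M)
    · have h0 : k q.1 * k q.2 = 0 := by
        rcases not_and_or.1 hq with h | h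
        · rw [image_eq_zero_of_notMem_tsupport h, zero_mul]
        · rw [image_eq_zero_of_notMem_tsupport h, mul_zero]
      rw [h0, zero_mul, zero_mul]
  have hbi : Integrable (fun q : ℝ × ℝ => ‖k q.1 * k q.2 * M‖) :=
    (noFastBlowDown_param_integrable k (fun _ => M) hk hkc continuous_const z).norm
  have hdiff : ∀ᵐ q ∂(volume : Measure (ℝ × ℝ)), ∀ z' ∈ Metric.ball z 1,
      HasDerivAt (fun s : ℝ => k q.1 * k q.2 * G !₂[q.1, q.2, s])
        (k q.1 * k q.2 * fderiv ℝ G !₂[q.1, q.2, z'] (EuclideanSpace.single 2 (1 : ℝ))) z' := by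
    refine ae_of_all _ fun q z' _ => ?_
    -- chain rule along the vertical line `s ↦ (q.1, q.2, s)` through `(q.1, q.2, z')`
    have hd : DifferentiableAt ℝ G !₂[q.1, q.2, z'] := (hG.differentiable one_ne_zero) _
    have hL : ∀ s : ℝ, (!₂[q.1, q.2, s] : EuclideanSpace ℝ (Fin 3)) =
        !₂[q.1, q.2, z'] + (s - z') • EuclideanSpace.single 2 (1 : ℝ) := by
      intro s
      ext i
      fin_cases i <;> simp
    have hline : HasDerivAt (fun s : ℝ => (!₂[q.1, q.2, s] : EuclideanSpace ℝ (Fin 3)))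
        (EuclideanSpace.single 2 (1 : ℝ)) z' := by
      rw [funext hL]
      simpa using (((hasDerivAt_id' z').sub_const z').smul_const
        (EuclideanSpace.single (2 : Fin 3) (1 : ℝ))).const_add (!₂[q.1, q.2, z'])
    exact (hd.hasFDerivAt.comp_hasDerivAt_of_eq z' hline (by simp)).const_mul (k q.1 * k q.2)
  exact (hasDerivAt_integral_of_dominated_loc_of_deriv_le
    (F := fun (s : ℝ) (q : ℝ × ℝ) => k q.1 * k q.2 * G !₂[q.1, q.2, s])
    (F' := fun (s : ℝ) (q : ℝ × ℝ) => k q.1 * k q.2 *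
      fderiv ℝ G !₂[q.1, q.2, s] (EuclideanSpace.single 2 (1 : ℝ)))
    (Metric.ball_mem_nhds z one_pos) hmeas hint hmeas' hbound hbi hdiff).2

/-! ## One-variable versions -/

/-- **Line integrals of the weighted traces.** For a continuous compactly supported weight `k`,
a continuous `H` on `ℝ³` and a height `z`: `y ↦ k(y) H(x, y, z)` is integrable for every `x`
and `x ↦ ∫ k(y) H(x, y, z) dy` is continuous (a parametric integral over the compact set
`tsupport k`), and symmetrically in the other horizontal variable. [folklore] -/
theorem noFastBlowDown_param_fubini_tools (k : ℝ → ℝ) (H : EuclideanSpace ℝ (Fin 3) → ℝ)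
    (hk : Continuous k) (hkc : HasCompactSupport k) (hH : Continuous H) (z : ℝ) :
    (∀ x : ℝ, Integrable (fun y : ℝ => k y * H !₂[x, y, z])) ∧
      Continuous (fun x : ℝ => ∫ y : ℝ, k y * H !₂[x, y, z]) ∧
      (∀ y : ℝ, Integrable (fun x : ℝ => k x * H !₂[x, y, z])) ∧
      Continuous (fun y : ℝ => ∫ x : ℝ, k x * H !₂[x, y, z]) := by
  have hKc : IsCompact (tsupport k) := hkc.isCompact
  refine ⟨fun x => ?_, ?_, fun y => ?_, ?_⟩
  · have hc : Continuous fun y : ℝ => k y * H !₂[x, y, z] := by fun_prop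
    exact hc.integrable_of_hasCompactSupport hkc.mul_right
  · have heq : (fun x : ℝ => ∫ y : ℝ, k y * H !₂[x, y, z]) =
        fun x => ∫ y in tsupport k, k y * H !₂[x, y, z] := by
      funext x
      refine (setIntegral_eq_integral_of_forall_compl_eq_zero fun y hy => ?_).symm
      rw [image_eq_zero_of_notMem_tsupport hy, zero_mul]
    rw [heq]
    exact continuous_parametric_integral_of_continuous
      (f := fun x y : ℝ => k y * H !₂[x, y, z]) (by fun_prop) hKc
  · have hc : Continuous fun x : ℝ => k x * H !₂[x, y, z] := by fun_prop
    exact hc.integrable_of_hasCompactSupport hkc.mul_right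
  · have heq : (fun y : ℝ => ∫ x : ℝ, k x * H !₂[x, y, z]) =
        fun y => ∫ x in tsupport k, k x * H !₂[x, y, z] := by
      funext y
      refine (setIntegral_eq_integral_of_forall_compl_eq_zero fun x hx => ?_).symm
      rw [image_eq_zero_of_notMem_tsupport hx, zero_mul]
    rw [heq]
    exact continuous_parametric_integral_of_continuous
      (f := fun y x : ℝ => k x * H !₂[x, y, z]) (by fun_prop) hKc

/-! ## The registered tools stub -/

/-- **Tools B2 of the rate obstruction (registered stub).** Conjunction of the four folklore
parametric-integral tools: continuity in the height of the horizontal weighted averages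
`∫∫ k(x) k(y) G(x, y, z)` of a continuous `G`; integrability of the weighted slice integrands;
differentiation of the averages under the integral sign for `C¹` maps `G`; and the one-variable
integrability / continuity statements behind Fubini on the slices. [folklore] -/
theorem stub_noFastBlowDownParamTools :
    (∀ (k : ℝ → ℝ) (G : EuclideanSpace ℝ (Fin 3) → ℝ), Continuous k → HasCompactSupport k →
      Continuous G →
      Continuous (fun z : ℝ => ∫ q : ℝ × ℝ, k q.1 * k q.2 * G !₂[q.1, q.2, z])) ∧
    (∀ (k : ℝ → ℝ) (G : EuclideanSpace ℝ (Fin 3) → ℝ), Continuous k → HasCompactSupport k →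
      Continuous G →
      ∀ z : ℝ, Integrable (fun q : ℝ × ℝ => k q.1 * k q.2 * G !₂[q.1, q.2, z])) ∧
    (∀ (k : ℝ → ℝ) (G : EuclideanSpace ℝ (Fin 3) → ℝ), Continuous k → HasCompactSupport k →
      ContDiff ℝ 1 G →
      ∀ z : ℝ, HasDerivAt (fun z : ℝ => ∫ q : ℝ × ℝ, k q.1 * k q.2 * G !₂[q.1, q.2, z])
        (∫ q : ℝ × ℝ, k q.1 * k q.2 *
          fderiv ℝ G !₂[q.1, q.2, z] (EuclideanSpace.single 2 (1 : ℝ))) z) ∧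
    (∀ (k : ℝ → ℝ) (H : EuclideanSpace ℝ (Fin 3) → ℝ), Continuous k → HasCompactSupport k →
      Continuous H → ∀ z : ℝ,
        (∀ x : ℝ, Integrable (fun y : ℝ => k y * H !₂[x, y, z])) ∧
        Continuous (fun x : ℝ => ∫ y : ℝ, k y * H !₂[x, y, z]) ∧
        (∀ y : ℝ, Integrable (fun x : ℝ => k x * H !₂[x, y, z])) ∧
        Continuous (fun y : ℝ => ∫ x : ℝ, k x * H !₂[x, y, z])) :=
  ⟨noFastBlowDown_param_continuous, noFastBlowDown_param_integrable,
    noFastBlowDown_param_hasDerivAt, noFastBlowDown_param_fubini_tools⟩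

end Summit.AnomalousDissipation.AnomalousDissipation.Theorems

end
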